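import Literature.MathematicalPhysics.QuantumManyBody.GroundStateFeynmanKacGaussian
import Literature.Probability.Process.BrownianRunningSup
import Mathlib.Probability.Independence.Basic
import Mathlib.Probability.Independence.Integration
import Mathlib.MeasureTheory.Measure.Haar.NormedSpace
import HarnessLib

/-!
# Ground-state Feynman–Kac: the Gaussian displacement of the world-lines

Topic `Literature/MathematicalPhysics/QuantumManyBody`; support file for the proof of the named
fact `Literature.MathematicalPhysics.QuantumManyBody.BoseGas.GroundStateFeynmanKac`
(variational identification of the top of the spectrum of the Feynman–Kac semigroup with the
Dirichlet form, Chung–Zhao (1995) Thm 3.27 / Prop 3.29, done by direct small-time Gaussian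
analysis). This file isolates the **displacement** `√2 b_t ∈ (ℝ³)^N` of the `N` world-lines
(`worldLine X ω t = X + displacement t ω`) and its Gaussian structure:

* `displacement t ω`, coordinates `√2 b_t(ω i k)`; measurable in `ω`, continuous in `t`, `0` at
  `t = 0`;
* `flatten N : PathSpace N ≃ᵐ (Fin N × Fin 3 → (ℝ≥0 → ℝ))` is measure preserving from
  `wienerPaths N` to the flat product of `3N` pre-Wiener measures (`measurePreserving_flatten`),
  whence the `3N` Brownian coordinates are independent: mixed moments vanish
  (`integral_brownian_mul_brownian`), `E[b_t(ω i k)²] = t`;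
* **covariance of the displacement**: `E[D_{ik} D_{jl}] = 2t δ` (`integral_displacement_mul`) and,
  for every continuous linear functional `ℓ` on `(ℝ³)^N`,
  `E[ℓ(√2 b_t)²] = 2t ∑_{i,k} ℓ(e_{ik})²` (`integral_clm_displacement_sq`), `e_{ik}` the coordinate
  vectors entering `kineticDensity`;
* the **standard Gaussian** `stdGaussian N` on `(ℝ³)^N` (density `∏ φ(z_{ik})`), a probability
  measure, and the **scaling representation** `E[F(√2 b_t)] = ∫ F(√(2t) z) dγ(z)`
  (`lintegral_stdGaussian_smul`, `map_smul_stdGaussian`, `integral_stdGaussian_smul`), by the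
  Gaussian density of `√2 b_t` (`map_displacement`) and Haar scaling of Lebesgue measure;
* first-moment bound `E‖√2 b_t‖ ≤ 6N √t` through the running supremum
  (`norm_displacement_le_sum_runSup`, `integral_norm_displacement_le`).

## References

* K. L. Chung, Z. Zhao, *From Brownian Motion to Schrödinger's Equation* (1995), (1.11), §3.3.
  [ChungZhao1995]
* D. Revuz, M. Yor, *Continuous Martingales and Brownian Motion* (1999), Ch. I–II. [RevuzYor1999]
-/

noncomputable section

namespace Literature.MathematicalPhysics.QuantumManyBody.BoseGas

open MeasureTheory ProbabilityTheory Filter Set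
open scoped ENNReal NNReal Topology
open Literature.Probability.Process

variable {N : ℕ}

/-! ### The displacement -/

/-- The **displacement** `√2 b_t(ω) ∈ (ℝ³)^N` of the world-lines at time `t`:
`(displacement t ω) i k = √2 · b_t(ω i k)`. [cite: ChungZhao1995, §3.3 (3.34)] -/
def displacement (t : ℝ≥0) (ω : PathSpace N) : Config N :=
  fun i => WithLp.toLp 2 fun k : Fin 3 => Real.sqrt 2 * brownian t (ω i k)

/-- Coordinates of the displacement. [folklore] -/
@[simp] theorem displacement_apply (t : ℝ≥0) (ω : PathSpace N) (i : Fin N) (k : Fin 3) :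
    displacement t ω i k = Real.sqrt 2 * brownian t (ω i k) := rfl

/-- `B_t = X + √2 b_t`. [folklore] -/
theorem worldLine_eq_add_displacement (X : Config N) (ω : PathSpace N) (t : ℝ≥0) :
    worldLine X ω t = X + displacement t ω := rfl

/-- The displacement is measurable in the sample. [folklore] -/
@[fun_prop]
theorem measurable_displacement (t : ℝ≥0) : Measurable (displacement (N := N) t) :=
  measurable_pi_lambda _ fun i => (WithLp.measurable_toLp 2 _).comp
    (measurable_pi_lambda _ fun k => ((measurable_brownian t).const_mul _).comp
      ((measurable_pi_apply k).comp (measurable_pi_apply i)))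

/-- The displacement is continuous in time. [folklore] -/
theorem continuous_displacement (ω : PathSpace N) : Continuous fun t => displacement t ω :=
  continuous_pi fun i => (PiLp.continuous_toLp 2 _).comp
    (continuous_pi fun k => continuous_const.mul (continuous_brownian (ω i k)))

/-- No displacement at time `0`. [folklore] -/
@[simp] theorem displacement_zero (ω : PathSpace N) : displacement 0 ω = 0 := by
  have h := worldLine_eq_add_displacement (0 : Config N) ω 0
  rw [worldLine_zero, zero_add] at h
  exact h.symm

/-- The displacement is jointly measurable in (time, sample). [folklore] -/
theorem measurable_displacement_uncurry :
    Measurable fun p : ℝ≥0 × PathSpace N => displacement p.1 p.2 :=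
  measurable_uncurry_of_continuous_of_measurable (u := fun (t : ℝ≥0) (ω : PathSpace N) =>
    displacement t ω) continuous_displacement measurable_displacement

/-- The law of the displacement at `t > 0` has the Gaussian density `∏ᵢₖ φ_{2t}(Y i k)`
(restatement of `map_displacement`). [folklore] -/
theorem map_displacement_eq {t : ℝ≥0} (ht : t ≠ 0) :
    (wienerPaths N).map (displacement t) =
      (volume : Measure (Config N)).withDensity
        fun Y => ∏ i, ∏ k, gaussianPDF 0 (2 * t) (Y i k) :=
  map_displacement ht

/-- The centred Gaussian product density `Y ↦ ∏ᵢₖ φ_v(Y i k)` is measurable. [folklore] -/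
theorem measurable_gaussDensity (v : ℝ≥0) :
    Measurable fun Y : Config N => ∏ i, ∏ k, gaussianPDF 0 v (Y i k) := by
  refine Finset.measurable_prod _ fun i _ => Finset.measurable_prod _ fun k _ => ?_
  exact (measurable_gaussianPDF _ _).comp ((measurable_pi_apply k).comp
    ((WithLp.measurable_ofLp 2 _).comp (measurable_pi_apply i)))

/-- Expectations of the displacement at `t > 0` are Gaussian integrals:
`E[F(√2 b_t)] = ∫ (∏ φ_{2t}(Y i k)) F(Y) dY`. [folklore] -/
theorem lintegral_displacement_eq {t : ℝ≥0} (ht : t ≠ 0) {F : Config N → ℝ≥0∞}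
    (hF : Measurable F) :
    ∫⁻ ω, F (displacement t ω) ∂wienerPaths N =
      ∫⁻ Y : Config N, (∏ i, ∏ k, gaussianPDF 0 (2 * t) (Y i k)) * F Y := by
  rw [← lintegral_map hF (measurable_displacement t), map_displacement_eq ht,
    lintegral_withDensity_eq_lintegral_mul _ (measurable_gaussDensity (2 * t)) hF]
  rfl

/-! ### Coordinates: marginals and independence -/

/-- Each path coordinate `ω ↦ ω i k` has the pre-Wiener law. [folklore] -/
theorem measurePreserving_apply₂ (i : Fin N) (k : Fin 3) :
    MeasurePreserving (fun ω : PathSpace N => ω i k) (wienerPaths N) preWienerMeasure := by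
  haveI := Literature.Probability.RandomPlanarGeometry.isProbabilityMeasure_preWienerMeasure'
  exact (measurePreserving_eval (μ := fun _ : Fin 3 => preWienerMeasure) k).comp
    (measurePreserving_eval (μ := fun _ : Fin N => Measure.pi fun _ : Fin 3 => preWienerMeasure) i)

/-- Expectations of a function of one path coordinate. [folklore] -/
theorem integral_comp_apply₂ (i : Fin N) (k : Fin 3) {g : (ℝ≥0 → ℝ) → ℝ}
    (hg : AEStronglyMeasurable g preWienerMeasure) :
    ∫ ω, g (ω i k) ∂wienerPaths N = ∫ η, g η ∂preWienerMeasure := by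
  rw [← (measurePreserving_apply₂ (N := N) i k).map_eq] at hg ⊢
  rw [integral_map (measurePreserving_apply₂ (N := N) i k).measurable.aemeasurable hg]

/-- Flattening the two-level product `PathSpace N = Fin N → Fin 3 → path` to a one-level product
over `Fin N × Fin 3`. [folklore] -/
def flatten (N : ℕ) : PathSpace N ≃ᵐ (Fin N × Fin 3 → (ℝ≥0 → ℝ)) :=
  (MeasurableEquiv.curry (Fin N) (Fin 3) (ℝ≥0 → ℝ)).symm

/-- The flattening reads the coordinate `(i, k)`. [folklore] -/
@[simp] theorem flatten_apply (ω : PathSpace N) (p : Fin N × Fin 3) :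
    flatten N ω p = ω p.1 p.2 := rfl

/-- **The flattening is measure preserving**: `wienerPaths N` is the product of `3N` independent
pre-Wiener measures. [folklore] -/
theorem measurePreserving_flatten :
    MeasurePreserving (flatten N) (wienerPaths N)
      (Measure.pi fun _ : Fin N × Fin 3 => preWienerMeasure) := by
  haveI := Literature.Probability.RandomPlanarGeometry.isProbabilityMeasure_preWienerMeasure'
  refine ⟨(flatten N).measurable, ?_⟩
  symm
  refine Measure.pi_eq fun s hs => ?_
  rw [Measure.map_apply (flatten N).measurable (MeasurableSet.univ_pi hs)]
  have hpre : flatten N ⁻¹' Set.univ.pi s =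
      Set.univ.pi fun i : Fin N => Set.univ.pi fun k : Fin 3 => s (i, k) := by
    ext ω
    simp only [Set.mem_preimage, Set.mem_univ_pi, flatten_apply, Prod.forall]
  rw [hpre, wienerPaths, Measure.pi_pi]
  simp_rw [Measure.pi_pi]
  rw [Fintype.prod_prod_type]

/-- **Independence of distinct Brownian coordinates**: mixed moments factorise and vanish,
`E[b_s(ω i k) b_t(ω j l)] = 0` for `(i, k) ≠ (j, l)`. [folklore] -/
theorem integral_brownian_mul_brownian (s t : ℝ≥0) {i j : Fin N} {k l : Fin 3}
    (h : (i, k) ≠ (j, l)) :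
    ∫ ω, brownian s (ω i k) * brownian t (ω j l) ∂wienerPaths N = 0 := by
  haveI := Literature.Probability.RandomPlanarGeometry.isProbabilityMeasure_preWienerMeasure'
  have key := (measurePreserving_flatten (N := N)).integral_comp'
    (fun η : Fin N × Fin 3 → (ℝ≥0 → ℝ) => brownian s (η (i, k)) * brownian t (η (j, l)))
  simp only [flatten_apply] at key
  rw [key]
  have hind : IndepFun (fun η : Fin N × Fin 3 → (ℝ≥0 → ℝ) => brownian s (η (i, k)))
      (fun η => brownian t (η (j, l))) (Measure.pi fun _ : Fin N × Fin 3 => preWienerMeasure) := by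
    have hI := iIndepFun_pi (μ := fun _ : Fin N × Fin 3 => preWienerMeasure)
      (X := fun p : Fin N × Fin 3 => if p = (i, k) then brownian s else brownian t)
      (fun p => by
        by_cases hp : p = (i, k)
        · simp only [hp, if_true]; exact (measurable_brownian _).aemeasurable
        · simp only [hp, if_false]; exact (measurable_brownian _).aemeasurable)
    have h2 := hI.indepFun h
    simp only [if_true, if_neg (Ne.symm h)] at h2
    exact h2
  rw [hind.integral_fun_mul_eq_mul_integral
    ((measurable_brownian s).comp (measurable_pi_apply _)).aestronglyMeasurable
    ((measurable_brownian t).comp (measurable_pi_apply _)).aestronglyMeasurable]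
  have h0 : ∫ η : Fin N × Fin 3 → (ℝ≥0 → ℝ), brownian s (η (i, k))
      ∂Measure.pi (fun _ : Fin N × Fin 3 => preWienerMeasure) = 0 := by
    have hmp := measurePreserving_eval (μ := fun _ : Fin N × Fin 3 => preWienerMeasure) (i, k)
    have hg : AEStronglyMeasurable (brownian s) preWienerMeasure :=
      (measurable_brownian s).aestronglyMeasurable
    rw [← hmp.map_eq] at hg
    have := integral_map hmp.measurable.aemeasurable hg
    rw [hmp.map_eq, integral_brownian_eq_zero] at this
    exact this.symm
  rw [h0, zero_mul]

/-- `E[b_t(ω i k)²] = t`. [folklore] -/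
theorem integral_brownian_coord_sq (t : ℝ≥0) (i : Fin N) (k : Fin 3) :
    ∫ ω, brownian t (ω i k) ^ 2 ∂wienerPaths N = t := by
  rw [integral_comp_apply₂ i k (g := fun η => brownian t η ^ 2)
    ((measurable_brownian t).pow_const 2).aestronglyMeasurable]
  exact integral_brownian_sq t

/-- `b_t(ω i k)` is square integrable. [folklore] -/
theorem memLp_two_brownian_coord (t : ℝ≥0) (i : Fin N) (k : Fin 3) :
    MemLp (fun ω : PathSpace N => brownian t (ω i k)) 2 (wienerPaths N) :=
  (Literature.Probability.RandomPlanarGeometry.memLp_two_brownian t).comp_measurePreserving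
    (measurePreserving_apply₂ i k)

/-- Products of Brownian coordinates are integrable. [folklore] -/
theorem integrable_brownian_mul_brownian (s t : ℝ≥0) (i j : Fin N) (k l : Fin 3) :
    Integrable (fun ω : PathSpace N => brownian s (ω i k) * brownian t (ω j l)) (wienerPaths N) :=
  (memLp_two_brownian_coord s i k).integrable_mul (memLp_two_brownian_coord t j l)

/-! ### Covariance of the displacement -/

/-- **Covariance of the displacement**: `E[D_{ik} D_{jl}] = 2t` if `(i,k) = (j,l)`, else `0`.
[folklore] -/
theorem integral_displacement_mul (t : ℝ≥0) (i j : Fin N) (k l : Fin 3) :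
    ∫ ω, displacement t ω i k * displacement t ω j l ∂wienerPaths N =
      if (i, k) = (j, l) then 2 * (t : ℝ) else 0 := by
  simp only [displacement_apply]
  have hre : ∀ ω : PathSpace N, Real.sqrt 2 * brownian t (ω i k) * (Real.sqrt 2 * brownian t (ω j l))
      = 2 * (brownian t (ω i k) * brownian t (ω j l)) := fun ω => by
    have h2 : Real.sqrt 2 * Real.sqrt 2 = 2 := Real.mul_self_sqrt zero_le_two
    linear_combination (brownian t (ω i k) * brownian t (ω j l)) * h2
  simp_rw [hre, integral_const_mul]
  split_ifs with h
  · obtain ⟨rfl, rfl⟩ := Prod.mk.inj h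
    simp_rw [← sq, integral_brownian_coord_sq]
  · rw [integral_brownian_mul_brownian t t h, mul_zero]

/-- Expansion of a configuration in the coordinate vectors `e_{ik} = Pi.single i (single k 1)`.
[folklore] -/
theorem config_eq_sum_smul_single (z : Config N) :
    z = ∑ i, ∑ k, (z i k) • (Pi.single i (EuclideanSpace.single k (1 : ℝ)) : Config N) := by
  ext j l
  simp only [Finset.sum_apply, WithLp.ofLp_sum, Pi.smul_apply, WithLp.ofLp_smul, Pi.single_apply]
  rw [Finset.sum_eq_single j (fun i _ hij => by simp [Ne.symm hij]) (by simp)]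
  simp only [if_true]
  rw [Finset.sum_eq_single l (fun k _ hkl => by simp [Ne.symm hkl]) (by simp)]
  simp

/-- A continuous linear functional of the displacement, in coordinates. [folklore] -/
theorem clm_displacement_eq_sum (ℓ : Config N →L[ℝ] ℝ) (t : ℝ≥0) (ω : PathSpace N) :
    ℓ (displacement t ω) =
      ∑ p : Fin N × Fin 3, displacement t ω p.1 p.2 *
        ℓ (Pi.single p.1 (EuclideanSpace.single p.2 (1 : ℝ))) := by
  conv_lhs => rw [config_eq_sum_smul_single (displacement t ω)]
  simp only [map_sum, map_smul, smul_eq_mul]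
  rw [Fintype.sum_prod_type]

/-- **Second moment of a linear functional of the displacement**:
`E[ℓ(√2 b_t)²] = 2t ∑_{i,k} ℓ(e_{ik})²`. [folklore] -/
theorem integral_clm_displacement_sq (ℓ : Config N →L[ℝ] ℝ) (t : ℝ≥0) :
    ∫ ω, (ℓ (displacement t ω)) ^ 2 ∂wienerPaths N =
      2 * (t : ℝ) * ∑ i, ∑ k, (ℓ (Pi.single i (EuclideanSpace.single k (1 : ℝ)))) ^ 2 := by
  set c : Fin N × Fin 3 → ℝ := fun p => ℓ (Pi.single p.1 (EuclideanSpace.single p.2 (1 : ℝ)))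
    with hc
  have hexp : ∀ ω : PathSpace N, (ℓ (displacement t ω)) ^ 2 =
      ∑ p : Fin N × Fin 3, ∑ q : Fin N × Fin 3,
        c p * c q * (displacement t ω p.1 p.2 * displacement t ω q.1 q.2) := by
    intro ω
    rw [clm_displacement_eq_sum, sq, Finset.sum_mul_sum]
    refine Finset.sum_congr rfl fun p _ => Finset.sum_congr rfl fun q _ => ?_
    simp only [hc]
    ring
  simp_rw [hexp]
  have hint : ∀ p q : Fin N × Fin 3, Integrable (fun ω : PathSpace N =>
      c p * c q * (displacement t ω p.1 p.2 * displacement t ω q.1 q.2)) (wienerPaths N) := by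
    intro p q
    refine Integrable.const_mul ?_ _
    simp only [displacement_apply]
    have : (fun ω : PathSpace N => Real.sqrt 2 * brownian t (ω p.1 p.2) *
        (Real.sqrt 2 * brownian t (ω q.1 q.2))) = fun ω =>
        (Real.sqrt 2 * Real.sqrt 2) * (brownian t (ω p.1 p.2) * brownian t (ω q.1 q.2)) := by
      funext ω; ring
    rw [this]
    exact (integrable_brownian_mul_brownian t t _ _ _ _).const_mul _
  rw [integral_finsetSum _ fun p _ => integrable_finsetSum _ fun q _ => hint p q]
  simp_rw [integral_finsetSum _ fun q _ => hint _ q, integral_const_mul,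
    integral_displacement_mul]
  simp only [mul_ite, mul_zero, Finset.sum_ite_eq, Finset.mem_univ, if_true]
  rw [Fintype.sum_prod_type, Finset.mul_sum]
  refine Finset.sum_congr rfl fun i _ => ?_
  rw [Finset.mul_sum]
  refine Finset.sum_congr rfl fun k _ => ?_
  simp only [hc]
  ring

/-! ### The standard Gaussian on `(ℝ³)^N` and the scaling representation -/

/-- The **standard Gaussian** `γ = N(0, I_{3N})` on `(ℝ³)^N`, as the measure with density
`∏ᵢₖ φ₁(z i k)` with respect to Lebesgue measure. [folklore] -/
def stdGaussian (N : ℕ) : Measure (Config N) :=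
  (volume : Measure (Config N)).withDensity fun z => ∏ i, ∏ k, gaussianPDF 0 1 (z i k)

/-- `2 · (1/2) = 1` in `ℝ≥0`. [folklore] -/
theorem two_mul_half_nnreal : (2 : ℝ≥0) * (1 / 2) = 1 := by
  ext; simp

/-- **The standard Gaussian is the law of the displacement at time `1/2`.** [folklore] -/
theorem map_displacement_half :
    (wienerPaths N).map (displacement (1 / 2)) = stdGaussian N := by
  rw [map_displacement_eq (by norm_num), stdGaussian]
  simp_rw [two_mul_half_nnreal]

/-- The standard Gaussian is a probability measure. [folklore] -/
instance isProbabilityMeasure_stdGaussian : IsProbabilityMeasure (stdGaussian N) := by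
  rw [← map_displacement_half]
  exact Measure.isProbabilityMeasure_map (measurable_displacement _).aemeasurable

/-- Gaussian scaling in one variable: `φ₁(x) = c · φ_{c²}(c x)` for `c = √(2t) > 0`. [folklore] -/
theorem gaussianPDFReal_one_eq {t : ℝ≥0} (ht : t ≠ 0) (x : ℝ) :
    gaussianPDFReal 0 1 x =
      Real.sqrt (2 * t) * gaussianPDFReal 0 (2 * t) (Real.sqrt (2 * t) * x) := by
  have ht' : (0 : ℝ) < t := lt_of_le_of_ne t.coe_nonneg (fun h => ht (by exact_mod_cast h.symm))
  have h2t : (0 : ℝ) < 2 * t := by positivity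
  set c := Real.sqrt (2 * (t : ℝ)) with hc
  have hcpos : 0 < c := Real.sqrt_pos.2 h2t
  have hcsq : c ^ 2 = 2 * t := Real.sq_sqrt h2t.le
  simp only [gaussianPDFReal, sub_zero, NNReal.coe_one, mul_one, NNReal.coe_mul, NNReal.coe_ofNat]
  rw [show (2 : ℝ) * Real.pi * (2 * t) = c ^ 2 * (2 * Real.pi) by rw [hcsq]; ring,
    Real.sqrt_mul (sq_nonneg c), Real.sqrt_sq hcpos.le]
  rw [mul_pow, hcsq]
  have hexp : -(2 * (t : ℝ) * x ^ 2) / (2 * (2 * (t : ℝ))) = -x ^ 2 / 2 := by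
    field_simp
  rw [hexp]
  field_simp

/-- Gaussian scaling of the product density: `∏ φ₁(z i k) = c^{3N} ∏ φ_{2t}(c z i k)`, in the
unevaluated product form. [folklore] -/
theorem gaussDensity_one_eq {t : ℝ≥0} (ht : t ≠ 0) (z : Config N) :
    (∏ i, ∏ k, gaussianPDF 0 1 (z i k)) =
      (∏ _i : Fin N, ∏ _k : Fin 3, ENNReal.ofReal (Real.sqrt (2 * t))) *
        ∏ i, ∏ k, gaussianPDF 0 (2 * t) ((Real.sqrt (2 * t) • z) i k) := by
  rw [← Finset.prod_mul_distrib]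
  refine Finset.prod_congr rfl fun i _ => ?_
  rw [← Finset.prod_mul_distrib]
  refine Finset.prod_congr rfl fun k _ => ?_
  rw [gaussianPDF, gaussianPDF, gaussianPDFReal_one_eq ht,
    ENNReal.ofReal_mul (Real.sqrt_nonneg _)]
  rfl

/-- The scaling constant: `c^{3N} · |c^{-dim}| = 1`. [folklore] -/
theorem scaling_const_mul_eq_one {c : ℝ} (hc : 0 < c) :
    (∏ _i : Fin N, ∏ _k : Fin 3, ENNReal.ofReal c) *
      ENNReal.ofReal |(c ^ Module.finrank ℝ (Config N))⁻¹| = 1 := by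
  -- `dim (ℝ³)^N = 3N` (also `finrank_config_eq` in `JelliumBoseGasCondensateDilation.lean`,
  -- outside this import cone)
  have hfin : Module.finrank ℝ (Config N) = 3 * N := by
    rw [Module.finrank_pi_fintype]
    simp [Finset.sum_const, mul_comm]
  rw [hfin]
  simp only [Finset.prod_const, Finset.card_univ, Fintype.card_fin]
  rw [← pow_mul, ← ENNReal.ofReal_pow hc.le, ← ENNReal.ofReal_mul (pow_nonneg hc.le _),
    abs_of_nonneg (inv_nonneg.2 (pow_nonneg hc.le _)), mul_comm 3 N,
    mul_inv_cancel₀ (pow_ne_zero _ hc.ne'), ENNReal.ofReal_one]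

/-- Haar scaling of lower Lebesgue integrals on `(ℝ³)^N`: `∫ f(c z) dz = |c^{-dim}| ∫ f`.
[folklore] -/
theorem lintegral_comp_smul_config (f : Config N → ℝ≥0∞) {c : ℝ} (hc : c ≠ 0) :
    ∫⁻ z : Config N, f (c • z) =
      ENNReal.ofReal |(c ^ Module.finrank ℝ (Config N))⁻¹| * ∫⁻ z, f z := by
  calc ∫⁻ z : Config N, f (c • z) = ∫⁻ y, f y ∂(Measure.map (c • ·) volume) :=
        (lintegral_map_equiv f
          (Homeomorph.smul (isUnit_iff_ne_zero.2 hc).unit).toMeasurableEquiv).symm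
    _ = _ := by
        rw [Measure.map_addHaar_smul volume hc, lintegral_smul_measure, smul_eq_mul]

/-- **Scaling representation** (lower integrals): for `t > 0` and measurable `F ≥ 0`,
`∫ F(√(2t) z) dγ(z) = E[F(√2 b_t)]`. [folklore] -/
theorem lintegral_stdGaussian_smul {t : ℝ≥0} (ht : t ≠ 0) {F : Config N → ℝ≥0∞}
    (hF : Measurable F) :
    ∫⁻ z, F (Real.sqrt (2 * t) • z) ∂stdGaussian N = ∫⁻ ω, F (displacement t ω) ∂wienerPaths N := by
  have ht' : (0 : ℝ) < t := lt_of_le_of_ne t.coe_nonneg (fun h => ht (by exact_mod_cast h.symm))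
  set c := Real.sqrt (2 * (t : ℝ)) with hc
  have hcpos : 0 < c := Real.sqrt_pos.2 (by positivity)
  have hmeas1 : Measurable fun z : Config N => ∏ i, ∏ k, gaussianPDF 0 1 (z i k) :=
    measurable_gaussDensity 1
  rw [stdGaussian, lintegral_withDensity_eq_lintegral_mul _ hmeas1
      (show Measurable (fun z : Config N => F (c • z)) from hF.comp (measurable_const_smul c)),
    lintegral_displacement_eq ht hF]
  simp only [Pi.mul_apply]
  simp_rw [gaussDensity_one_eq (N := N) ht, mul_assoc]
  rw [lintegral_const_mul' _ _ (by
      refine ne_of_lt (ENNReal.prod_lt_top fun i _ => ENNReal.prod_lt_top fun k _ => ?_)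
      exact ENNReal.ofReal_lt_top)]
  have hsc := lintegral_comp_smul_config
    (fun Y : Config N => (∏ i, ∏ k, gaussianPDF 0 (2 * t) (Y i k)) * F Y) hcpos.ne'
  simp only at hsc
  rw [hsc, ← mul_assoc, scaling_const_mul_eq_one hcpos, one_mul]

/-- **Scaling representation** (laws): `law(√(2t) · Z) = law(√2 b_t)` for `Z ~ γ`, `t > 0`.
[folklore] -/
theorem map_smul_stdGaussian {t : ℝ≥0} (ht : t ≠ 0) :
    (stdGaussian N).map (fun z => Real.sqrt (2 * t) • z) = (wienerPaths N).map (displacement t) := by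
  ext s hs
  rw [Measure.map_apply (measurable_const_smul _) hs, Measure.map_apply (measurable_displacement t) hs,
    ← lintegral_indicator_one (measurable_const_smul _ hs),
    ← lintegral_indicator_one (measurable_displacement t hs)]
  have h1 : (fun z : Config N => ((fun z => Real.sqrt (2 * ↑t) • z) ⁻¹' s).indicator
      (1 : Config N → ℝ≥0∞) z) = fun z => s.indicator 1 (Real.sqrt (2 * ↑t) • z) := by
    funext z
    by_cases hz : Real.sqrt (2 * ↑t) • z ∈ s
    · rw [Set.indicator_of_mem hz, Set.indicator_of_mem (show z ∈ _ ⁻¹' s from hz)]; rfl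
    · rw [Set.indicator_of_notMem hz, Set.indicator_of_notMem (show z ∉ _ ⁻¹' s from hz)]
  have h2 : (fun ω : PathSpace N => (displacement t ⁻¹' s).indicator (1 : PathSpace N → ℝ≥0∞) ω) =
      fun ω => s.indicator 1 (displacement t ω) := by
    funext ω
    by_cases hω : displacement t ω ∈ s
    · rw [Set.indicator_of_mem hω, Set.indicator_of_mem (show ω ∈ _ ⁻¹' s from hω)]; rfl
    · rw [Set.indicator_of_notMem hω, Set.indicator_of_notMem (show ω ∉ _ ⁻¹' s from hω)]
  rw [h1, h2]
  exact lintegral_stdGaussian_smul ht (measurable_one.indicator hs)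

/-- **Scaling representation** (Bochner integrals): for `t > 0` and (a.e. strongly measurable)
`F`, `∫ F(√(2t) z) dγ(z) = E[F(√2 b_t)]`. [folklore] -/
theorem integral_stdGaussian_smul {E : Type*} [NormedAddCommGroup E] [NormedSpace ℝ E]
    {t : ℝ≥0} (ht : t ≠ 0) {F : Config N → E} (hF : AEStronglyMeasurable F volume) :
    ∫ z, F (Real.sqrt (2 * t) • z) ∂stdGaussian N = ∫ ω, F (displacement t ω) ∂wienerPaths N := by
  have hac : (wienerPaths N).map (displacement t) ≪ volume := by
    rw [map_displacement_eq ht]; exact withDensity_absolutelyContinuous _ _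
  have hF' : AEStronglyMeasurable F ((wienerPaths N).map (displacement t)) := hF.mono_ac hac
  rw [← integral_map (measurable_displacement t).aemeasurable hF', ← map_smul_stdGaussian ht]
  have ht' : (0 : ℝ) < t := lt_of_le_of_ne t.coe_nonneg (fun h => ht (by exact_mod_cast h.symm))
  have hc : Real.sqrt (2 * (t : ℝ)) ≠ 0 := (Real.sqrt_pos.2 (by positivity)).ne'
  exact (integral_map_equiv
    (Homeomorph.smul (isUnit_iff_ne_zero.2 hc).unit).toMeasurableEquiv F).symm

/-- Integrals against `γ` are expectations of the displacement at time `1/2`. [folklore] -/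
theorem integral_stdGaussian_eq {E : Type*} [NormedAddCommGroup E] [NormedSpace ℝ E]
    {F : Config N → E} (hF : AEStronglyMeasurable F volume) :
    ∫ z, F z ∂stdGaussian N = ∫ ω, F (displacement (1 / 2) ω) ∂wienerPaths N := by
  have h := integral_stdGaussian_smul (N := N) (t := 1 / 2) (by norm_num) hF
  have h1 : Real.sqrt (2 * ((1 / 2 : ℝ≥0) : ℝ)) = 1 := by norm_num
  simp_rw [h1, one_smul] at h
  exact h

/-- **Second moments of the standard Gaussian**: `∫ ℓ(z)² dγ = ∑_{i,k} ℓ(e_{ik})²`. [folklore] -/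
theorem integral_clm_sq_stdGaussian (ℓ : Config N →L[ℝ] ℝ) :
    ∫ z, (ℓ z) ^ 2 ∂stdGaussian N =
      ∑ i, ∑ k, (ℓ (Pi.single i (EuclideanSpace.single k (1 : ℝ)))) ^ 2 := by
  rw [integral_stdGaussian_eq (F := fun z => (ℓ z) ^ 2) (by fun_prop),
    integral_clm_displacement_sq]
  norm_num

/-! ### First-moment bound through the running supremum -/

/-- The sup-norm of the displacement at any time `s ≤ t` is at most `√2 ∑_{i,k} runSup t (ω i k)`.
[folklore] -/
theorem norm_displacement_le_sum_runSup {s t : ℝ≥0} (hs : s ≤ t) (ω : PathSpace N) :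
    ‖displacement s ω‖ ≤ Real.sqrt 2 * ∑ i, ∑ k, runSup t (ω i k) := by
  have h0 : 0 ≤ Real.sqrt 2 * ∑ i, ∑ k, runSup t (ω i k) :=
    mul_nonneg (Real.sqrt_nonneg _) (Finset.sum_nonneg fun i _ =>
      Finset.sum_nonneg fun k _ => runSup_nonneg _ _)
  refine (pi_norm_le_iff_of_nonneg h0).2 fun i => ?_
  calc ‖displacement s ω i‖ ≤ ∑ k, ‖displacement s ω i k‖ := by
        rw [EuclideanSpace.norm_eq]
        refine Real.sqrt_le_iff.2 ⟨Finset.sum_nonneg fun k _ => norm_nonneg _, ?_⟩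
        exact Finset.sum_sq_le_sq_sum_of_nonneg fun k _ => norm_nonneg _
    _ ≤ ∑ k, Real.sqrt 2 * runSup t (ω i k) := by
        refine Finset.sum_le_sum fun k _ => ?_
        rw [displacement_apply, norm_mul, Real.norm_of_nonneg (Real.sqrt_nonneg _), Real.norm_eq_abs]
        exact mul_le_mul_of_nonneg_left (abs_brownian_le_runSup hs _) (Real.sqrt_nonneg _)
    _ = Real.sqrt 2 * ∑ k, runSup t (ω i k) := by rw [Finset.mul_sum]
    _ ≤ Real.sqrt 2 * ∑ i, ∑ k, runSup t (ω i k) := by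
        refine mul_le_mul_of_nonneg_left ?_ (Real.sqrt_nonneg _)
        exact Finset.single_le_sum (f := fun i => ∑ k, runSup t (ω i k))
          (fun i _ => Finset.sum_nonneg fun k _ => runSup_nonneg _ _) (Finset.mem_univ i)

/-- The running supremum of a coordinate is integrable. [folklore] -/
theorem integrable_runSup_coord (t : ℝ≥0) (i : Fin N) (k : Fin 3) :
    Integrable (fun ω : PathSpace N => runSup t (ω i k)) (wienerPaths N) :=
  (measurePreserving_apply₂ i k).integrable_comp_of_integrable (integrable_runSup t)

/-- The sum of the running suprema of the coordinates is integrable. [folklore] -/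
theorem integrable_sum_runSup (t : ℝ≥0) :
    Integrable (fun ω : PathSpace N => ∑ i, ∑ k, runSup t (ω i k)) (wienerPaths N) :=
  integrable_finsetSum _ fun i _ => integrable_finsetSum _ fun k _ => integrable_runSup_coord t i k

/-- `E[∑_{i,k} runSup t (ω i k)] ≤ 3N · 2√t`. [folklore] -/
theorem integral_sum_runSup_le (t : ℝ≥0) :
    ∫ ω, ∑ i, ∑ k, runSup t (ω i k) ∂wienerPaths N ≤ (3 * N : ℕ) * (2 * Real.sqrt t) := by
  rw [integral_finsetSum _ fun i _ => integrable_finsetSum _ fun k _ => integrable_runSup_coord t i k]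
  calc ∑ i, ∫ ω, ∑ k, runSup t (ω i k) ∂wienerPaths N
      = ∑ i : Fin N, ∑ k : Fin 3, ∫ ω, runSup t (ω i k) ∂wienerPaths N := by
        refine Finset.sum_congr rfl fun i _ => ?_
        exact integral_finsetSum _ fun k _ => integrable_runSup_coord t i k
    _ ≤ ∑ _i : Fin N, ∑ _k : Fin 3, 2 * Real.sqrt t := by
        refine Finset.sum_le_sum fun i _ => Finset.sum_le_sum fun k _ => ?_
        rw [integral_comp_apply₂ i k (measurable_runSup t).aestronglyMeasurable]
        exact integral_runSup_le t
    _ = (3 * N : ℕ) * (2 * Real.sqrt t) := by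
        simp only [Finset.sum_const, Finset.card_univ, Fintype.card_fin, nsmul_eq_mul, Nat.cast_mul,
          Nat.cast_ofNat]
        ring

/-- **First-moment bound for the displacement**: `E‖√2 b_s‖ ≤ √2 · 3N · 2√t` for `s ≤ t`.
[folklore] -/
theorem integral_norm_displacement_le {s t : ℝ≥0} (hs : s ≤ t) :
    ∫ ω, ‖displacement s ω‖ ∂wienerPaths N ≤ Real.sqrt 2 * ((3 * N : ℕ) * (2 * Real.sqrt t)) := by
  calc ∫ ω, ‖displacement s ω‖ ∂wienerPaths N
      ≤ ∫ ω, Real.sqrt 2 * ∑ i, ∑ k, runSup t (ω i k) ∂wienerPaths N := by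
        refine integral_mono_of_nonneg (Eventually.of_forall fun ω => norm_nonneg _)
          ((integrable_sum_runSup t).const_mul _)
          (Eventually.of_forall fun ω => norm_displacement_le_sum_runSup hs ω)
    _ ≤ Real.sqrt 2 * ((3 * N : ℕ) * (2 * Real.sqrt t)) := by
        rw [integral_const_mul]
        exact mul_le_mul_of_nonneg_left (integral_sum_runSup_le t) (Real.sqrt_nonneg _)

end Literature.MathematicalPhysics.QuantumManyBody.BoseGas

end
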